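import Literature.NumberTheory.EllipticCurves.AdditiveReductionRamifiedTorsionProofs
import HarnessLib

/-!
# `E[n] ⊆ E(F)` for `n` with two prime factors `≥ 3` ⇒ `E/F` semistable everywhere
# ([IUTchIV] Prop. 1.8 (v) in the "rational torsion points" phrasing of [IUTchI] Def. 3.1)

`Proofs` file (theorems only), topic `NumberTheory/EllipticCurves`; a thin adapter over
`AdditiveReductionRamifiedTorsionProofs` (Raynaud's criterion, number-field form:
`WeierstrassCurve.isSemistable_of_forall_smul_geomTorsion_eq_of_ne`).  There rationality of the
`p`-torsion is phrased as "`Γ_F` acts trivially on `E[p] = geomTorsion W p`"; the abc-iut consumers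
([IUTchI] Def. 3.1 (b) "the `2·3`-torsion points of `E_F` are rational over `F`", typed in
`Literature/IUT/HodgeTheaters/InitialThetaData.lean` as `torsion_six_rational : ∀ P, (6 : ℤ) • P = 0 →
P ∈ Set.range (Affine.Point.baseChange F F̄)`; [IUTchIV] Thm. 1.10 / Cor. 2.2: "the `(3·5)`-torsion points
of `E_F` are defined over `F`") phrase it as "every `F̄`-point killed by `n` comes from an `F`-point".
This file converts: an `F̄`-point in the range of base change is fixed by `Gal(F̄/F)`
(`Affine.Point.map_baseChange`), whence

* `WeierstrassCurve.smul_eq_of_mem_range_baseChange` — Galois fixes `F`-rational points of `E(F̄)`;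
* `WeierstrassCurve.isSemistableAt_of_torsion_rational` — `E[p]` `F`-rational (`p ≥ 3` prime) ⇒ `E`
  semistable at every `v ∤ p` (= [IUTchIV] Prop. 1.8 (v), p. 19, number-field form);
* `WeierstrassCurve.isSemistable_of_torsion_rational_of_ne` — `E[p]`, `E[q]` `F`-rational for distinct
  primes `p, q ≥ 3` ⇒ `W.IsSemistable (𝓞 F)`;
* `WeierstrassCurve.isSemistable_of_torsion_rational_fifteen` — **`E[15] ⊆ E(F)` ⇒ `E/F` semistable at
  every finite place** — verbatim the field `isSemistable : E.IsSemistable (𝓞 F)` of [IUTchI] Def. 3.1 (b)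
  for the initial Θ-data of [IUTchIV] Cor. 2.2 (ii) (P7), whose field is `F = F_tpd(√−1, E[3·5])`.

Classical; nothing here bears on [IUTchIII] Cor. 3.12 (IUT locators = where the fact is consumed).

References: [SilvermanAEC2009] Thm. VII.6.1, proof of Thm. VII.7.1; [Mochizuki2012] IUTchIV Prop. 1.8 (v)
p. 19, Thm. 1.10 p. 22; IUTchI Def. 3.1 (b) p. 61.
-/

noncomputable section

open scoped Classical
open NumberField IsDedekindDomain Field

universe u

namespace WeierstrassCurve

open Literature.NumberTheory.EllipticCurves

variable {F : Type u} [Field F] [NumberField F] (W : WeierstrassCurve F)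

omit [NumberField F] in
/-- `Gal(F̄/F)` fixes the `F`-rational points of `E(F̄)`: if `P = P₀ ⊗ F̄` for an `F`-point `P₀`, then
`σ • P = P` for every `σ ∈ Γ_F` (Mathlib `Affine.Point.map_baseChange`; Silverman *AEC* VIII.§1).
[cite: SilvermanAEC2009, VIII.§1] -/
theorem smul_eq_of_mem_range_baseChange (σ : absoluteGaloisGroup F) {P : geomPoints W}
    (hP : P ∈ Set.range (Affine.Point.baseChange (W' := W.toAffine) F (AlgebraicClosure F))) :
    σ • P = P := by
  obtain ⟨P₀, rfl⟩ := hP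
  exact Affine.Point.map_baseChange (W' := W.toAffine)
    (absoluteGaloisGroup.toAlgEquiv F σ : AlgebraicClosure F →ₐ[F] AlgebraicClosure F) P₀

omit [NumberField F] in
/-- From "every `F̄`-point killed by `n` is `F`-rational" to "`Γ_F` acts trivially on `E[n]`".
[cite: SilvermanAEC2009, VIII.§1] -/
theorem forall_smul_geomTorsion_eq_of_torsion_rational {n : ℤ}
    (hrat : ∀ P : geomPoints W, n • P = 0 →
      P ∈ Set.range (Affine.Point.baseChange (W' := W.toAffine) F (AlgebraicClosure F)))
    (σ : absoluteGaloisGroup F) (Q : geomTorsion W n) : σ • Q = Q := by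
  apply Subtype.ext
  rw [Literature.NumberTheory.EllipticCurves.AddSubgroup.torsionBy.coe_smul]
  exact W.smul_eq_of_mem_range_baseChange σ (hrat Q.1 ((Submodule.mem_torsionBy_iff n Q.1).mp Q.2))

/-- **[IUTchIV] Prop. 1.8 (v), "rational torsion points" phrasing**: if every `F̄`-point of `E` killed by
the prime `p ≥ 3` is `F`-rational, then `E/F` has semistable reduction at every finite place `v ∤ p`.
[cite: Mochizuki2012, IUTchIV Prop 1.8 (v) p.19] [cite: SilvermanAEC2009, Thm. VII.6.1 and proof of Thm. VII.7.1] -/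
theorem isSemistableAt_of_torsion_rational [W.IsElliptic] {p : ℕ} (hp : p.Prime) (hp3 : 3 ≤ p)
    (hrat : ∀ P : geomPoints W, (p : ℤ) • P = 0 →
      P ∈ Set.range (Affine.Point.baseChange (W' := W.toAffine) F (AlgebraicClosure F)))
    (v : HeightOneSpectrum (𝓞 F)) (hpv : (p : 𝓞 F) ∉ v.asIdeal) : W.IsSemistableAt v :=
  W.isSemistableAt_of_forall_smul_geomTorsion_eq hp hp3
    (W.forall_smul_geomTorsion_eq_of_torsion_rational hrat) v hpv

/-- Two distinct primes `p, q ≥ 3` with `E[p]`, `E[q]` both `F`-rational ⇒ `E/F` is semistable at every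
finite place. [cite: Mochizuki2012, IUTchIV Prop 1.8 (v) p.19] [cite: SilvermanAEC2009, Thm. VII.6.1] -/
theorem isSemistable_of_torsion_rational_of_ne [W.IsElliptic] {p q : ℕ} (hp : p.Prime) (hq : q.Prime)
    (hp3 : 3 ≤ p) (hq3 : 3 ≤ q) (hpq : p ≠ q)
    (hratp : ∀ P : geomPoints W, (p : ℤ) • P = 0 →
      P ∈ Set.range (Affine.Point.baseChange (W' := W.toAffine) F (AlgebraicClosure F)))
    (hratq : ∀ P : geomPoints W, (q : ℤ) • P = 0 →
      P ∈ Set.range (Affine.Point.baseChange (W' := W.toAffine) F (AlgebraicClosure F))) :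
    W.IsSemistable (𝓞 F) :=
  W.isSemistable_of_forall_smul_geomTorsion_eq_of_ne hp hq hp3 hq3 hpq
    (W.forall_smul_geomTorsion_eq_of_torsion_rational hratp)
    (W.forall_smul_geomTorsion_eq_of_torsion_rational hratq)

/-- **`E[15] ⊆ E(F)` ⇒ `E/F` semistable at every finite place** ("the `(3·5)`-torsion points of `E_F` are
defined over `F`", [IUTchIV] Thm. 1.10, with `F = F_mod(√−1, E_{F_mod}[2·3·5])`; this is the field
`isSemistable : E.IsSemistable (𝓞 F)` of [IUTchI] Def. 3.1 (b) for the initial Θ-data built in the proof of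
[IUTchIV] Cor. 2.2 (ii), (P7)): points killed by `3` or by `5` are killed by `15`.
[cite: Mochizuki2012, IUTchIV Thm 1.10 p.22 and Prop 1.8 (v) p.19] [cite: SilvermanAEC2009, Thm. VII.6.1] -/
theorem isSemistable_of_torsion_rational_fifteen [W.IsElliptic]
    (hrat : ∀ P : geomPoints W, (15 : ℤ) • P = 0 →
      P ∈ Set.range (Affine.Point.baseChange (W' := W.toAffine) F (AlgebraicClosure F))) :
    W.IsSemistable (𝓞 F) := by
  refine W.isSemistable_of_torsion_rational_of_ne (p := 3) (q := 5) (by norm_num) (by norm_num)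
    le_rfl (by norm_num) (by norm_num) (fun P hP ↦ hrat P ?_) (fun P hP ↦ hrat P ?_)
  · have h : ((3 : ℕ) : ℤ) • P = 0 := hP
    rw [show (15 : ℤ) = 5 * ((3 : ℕ) : ℤ) by norm_num, mul_smul, h, smul_zero]
  · have h : ((5 : ℕ) : ℤ) • P = 0 := hP
    rw [show (15 : ℤ) = 3 * ((5 : ℕ) : ℤ) by norm_num, mul_smul, h, smul_zero]

end WeierstrassCurve

end
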